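import Literature.Claims.NS.Kovacevic2016
import HarnessLib

/-!
# Solo salvage for claim C114 `Kovacevic2016` (cell `ns-claims`, D-0090, QUICK row): Step 2 ((1.196))

Claim skeleton: `Literature/Claims/NS/Kovacevic2016.lean` (typist-1 g2, p480245): a «no pressure for a
prescribed steady velocity» statement (wrong-problem class; certificates `Theorems/SoloRefuteKovacevic2016.lean`,
refuter-8). The composition `claim_of_steps` consumes Steps 2 and 4. This file (seat `ns-claims-salvage-p2`)
discharges the trivially true one:

* `eq196_holds : Eq196` — (1.196) p.24 «∂u⃗/∂t = 0⃗ for any x⃗ ∈ ℝ³, t ≥ 0» for the FROZEN field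
  `(t,x) ↦ u(x)`: the one-sided time derivative of a constant is zero. With it, `claim_of_steps` needs only
  Step 4 (`NoPressure`, the load-bearing content) besides the unused binders (`claim_of_noPressure`).

Not kernelled (recorded in `claims/Kovacevic2016/SALVAGE.md`): `ClaimedTheorem` itself is TRUE in its own
(frozen-velocity) reading for `ν > 0` — `curl(νΔu − (u·∇)u)(0) = −80ν(1,1,1) ≠ 0`, so `νΔu + f(·,0) − (u·∇)u`
is no gradient — a statement about a prescribed field, not about the Cauchy problem.

WHAT THIS IS NOT: not a claim about NS regularity or blow-up; not a claim about any author beyond the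
typed locator.
-/

noncomputable section

open Set

-- The mandated landing namespace repeats the summit name by design (D-0017).
set_option linter.dupNamespace false

namespace Summit.NavierStokesRegularity.NavierStokesRegularity.Theorems

namespace Kovacevic2016

open Literature.Claims.NS.Kovacevic2016

/-- **Step 2 HOLDS ((1.196) p.24)**: the prescribed time-independent velocity `(t,x) ↦ u(x)` has zero
(one-sided) time derivative at every `t ≥ 0`. [cite: Kovacevic2016, (1.196) p.24] -/
theorem eq196_holds : Literature.Claims.NS.Kovacevic2016.Eq196 := by
  intro t x _
  show derivWithin (fun _ : ℝ => uField x) (Ici 0) t = 0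
  exact congrFun (derivWithin_const (Ici (0 : ℝ)) (uField x)) t

/-- Bookkeeping: with Step 2 discharged, the kernel composition needs Step 4 (`NoPressure`) and the unused
binders Steps 1, 3, 5. [cite: Kovacevic2016, proof of Theorem 1.1, p.26] -/
theorem claim_of_noPressure (h₁ : FieldProperties) (h₃ : Eq198_200) (h₄ : NoPressure)
    (h₅ : Indeterminate208) : Literature.Claims.NS.Kovacevic2016.ClaimedTheorem :=
  claim_of_steps h₁ eq196_holds h₃ h₄ h₅

end Kovacevic2016

end Summit.NavierStokesRegularity.NavierStokesRegularity.Theorems
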